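import Literature.IUT.HodgeArakelov.ThetaEnvDataRecordModel
import Literature.IUT.HodgeArakelov.EtaleThetaDataOfSettingKummerTower
import Literature.IUT.HodgeArakelov.MonoThetaProjectiveBridgeEtTh

/-!
# [IUTchII] Prop. 3.1 (ii) at the genuine record over `Π = Π^tp_X̲̲` with the constants `ℚ̄_pˣ ⊇ O` acted on through
# `ε`: the input `hinj` and the coefficient datum `c` DISCHARGED from the cyclotome tower — proof companion

Proof-only companion (abc-iut cell, D-0067 wave 4, seat abc-iut-w4-d007 gen 3; layer L6; node **IUTchII:Prop3.1(ii)**,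
sub-DAG `plan/L6/SUBDAG-IUTchII-Prop-31-33-34.md` W6-S6 row (γ) / junction J4; GAP-LEDGER G-w4d019-1) to
abc-iut-w4-d019's `ThetaEnvDataRecordModel.lean` (p419125 / v2 p420169: the genuine record `EtaleLevels.thetaEnvRecordKummer`
and **`prop31ii_thetaEnvRecordKummer`** — [IUTchII] Prop. 3.1 (ii) BOTH printed clauses at the genuine record under the ONE input
`hinj`, "injectivity of the Kummer map into the limit"), whose HANDOFF names as open for THIS lineage: "(i) `hinj` at the
`EtaleLevels` setting (needs the `MulDistribMulAction` of `Π^tp_X̲̲` on `ℚ̄_pˣ` through `ε` + d007's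
`h1LimKummer_injective_of_aug`)".  Supplied here from this seat's `EtaleThetaDataOfSettingGaloisUnits.lean` (p418848: the action
`unitsAction`, `h1LimKummer_injective_of_coeff`) and `EtaleThetaDataOfSettingKummerTower.lean` (p422741:
`exists_cyclotomeCoefficients_of_cyclotomeTower`).  No definitions; nothing of abc-iut-w4-d019's file is restated.

S. Mochizuki, *Inter-universal Teichmüller theory II*, kurims manuscript (Dec. 2020), Prop. 3.1 (ii) p. 88: "`Ψ_cns(M^Θ_*) :=
M_TM(M^Θ_*) ⊆ lim_J H¹(Π_Ÿ(M^Θ_*)|_J, Π_μ(M^Θ_*))` [where J is as in (i)] for constructing a 'monoid of constants' — i.e., which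
is naturally isomorphic to `O^▷_{F̄_v}` … — equipped with a natural conjugation action by `Π_X(M^Θ_*)`"
[cite: Mochizuki2012, Prop 3.1 (ii) p.88]; *The étale theta function …*, Cor. 2.19 (ii) p. 290
[cite: MochizukiEtTh2009, Cor 2.19 (ii) p.64].  Claim key `Mochizuki2012` (D-0012, DISPUTED); nothing here takes a side on
[IUTchIII] Cor. 3.12.

WHAT IS DISCHARGED.  At the constants `A := ℚ̄_pˣ` with the Galois action of `Π^tp_X̲̲` through `ε` (`unitsAction`), for ANY
`Π^tp_X̲̲`-stable submonoid `O ≤ ℚ̄_pˣ` (print: `O^▷_{F̄_v}`; also `𝒪^×`, all of `ℚ̄_pˣ`) and any `ι₀`: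
* the coefficient datum `c : CyclotomeCoefficients (phi C) (l·Δ_Θ) ℚ̄_pˣ` of `thetaEnvRecordKummer` is no longer free — it is
  the bijective change of coefficient cyclotome inverse to the model's own identifications, `(mods M).red (c ζ) = ζ_M`
  (`exists_cyclotomeCoefficients_of_cyclotomeTower` on abc-iut-w4-d043's chain tower `EtaleLevels.cyclotomeTower mods hmods`);
* `hinj` is the THEOREM `h1LimKummer_injective_of_coeff` (`ε(Π^tp_Ÿ̲̲) = G_K` has finite index; `c` bijective).
PROVED: **`EtaleLevels.prop31ii_thetaEnvRecordKummer_of_cyclotomeTower`** — given `hO : IsEtThOrigin` (F-2498) and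
`hΔ : IsCompact Δ_Θ` (GAP-LEDGER G-w5d187-1), THERE IS such a `c` for which all three conclusions of
`prop31ii_thetaEnvRecordKummer` hold: `Ψ_cns` is conjugation-stable; there is an isomorphism `O ⥲ Ψ_cns` which IS the
Kummer map on elements, intertwines the action of `Π^tp_X̲̲` on `O` with the conjugation action, and is unique as such;
`κ(x) ∈ M^×_TM ↔ x` is a unit.  Residual named inputs of Prop. 3.1 (ii) at the genuine record: abc-iut-w4-d030/d043's
model data (`mods`/`hmods`/`h15`/`L`/`hZ`/`hcharY`/`hlim`, the natural projective system) + `IsEtThOrigin` + `IsCompact Δ_Θ`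
— and the READING flag of abc-iut-w4-d019's v2 note (the inversion family of `thetaEnvRecord` is the element-induced one;
the clauses proved here concern `Ψ_cns`/`M^×_TM` and do not depend on that family; the same composition applies verbatim
to the outer-inversion record once it lands).  Typed ≠ proved for the residual inputs; instantiated ≠ endorsed.
-/

noncomputable section

namespace Literature.IUT.HodgeArakelov

open Literature.AnabelianGeometry.EtaleTheta CohomologySystemOfContH1 EtaleThetaDataOfSetting

namespace EtaleLevels

variable {p : ℕ} [Fact p.Prime] {D : Literature.AnabelianGeometry.EtaleTheta.ThetaSetting p}
  {E : D.EtaleThetaData} {l : ℕ} (C : E.DoubleUnderline l) (hC : D.Compat) (hS : D.Sec2Hyps)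
  (hl : l.Prime) (hp2 : p ≠ 2) (hpl : p ≠ l) (hζ : ∃ ζ : D.K, IsPrimitiveRoot ζ (4 * l))
  (mods : ∀ M : ℕ+, D.CyclotomeMod l M)
  (f : contCocycles D.toTheta D.DeltaTheta C.GtpYdduu) (hf : f ∈ C.rootCocycles hC)
  (hmods : ∀ (M M' : ℕ+) (h : (M : ℕ) ∣ (M' : ℕ)) (x : D.lDeltaTheta l),
    MuN.red p M M' h ((mods M').red x) = (mods M).red x)
  (h15 : Literature.AnabelianGeometry.EtaleTheta.ThetaSetting.Prop15iii E hC) (L : C.CuspLabels)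
  (hZ : ∀ M : ℕ+, Nonempty (ModelCyclotomes.lDeltaQuot (C.rigidData (mods M) hC hS h15 L) ≃*
    Literature.IUT.HodgeTheaters.ZHat))
  (hcharY : EtaleThetaDataOfSetting.PiYddCharacteristic C)
  (hlim : Function.Bijective (rigidLimHom C hC hS hl hp2 hpl hζ mods f hf hmods h15 L hZ))
  [(EtaleThetaDataOfSetting.PiYdd C).Normal]
  (O : Submonoid (PadicAlgCl p)ˣ) (hO : ∀ (σ : Pi C) (b : (PadicAlgCl p)ˣ), b ∈ O → σ • b ∈ O) (ι₀ : Pi C)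

include hO in
/-- **[IUTchII] Prop. 3.1 (ii) at the genuine record, constants `ℚ̄_pˣ ⊇ O` through `ε`, `hinj` and `c` DISCHARGED.**
Given the origin guard `hO'` and compactness of `Δ_Θ`, there is a BIJECTIVE change of coefficient cyclotome
`c : Λ(ℚ̄_pˣ) = Ẑ(1) ⥲ l·Δ_Θ`, inverse to the model's identifications (`(mods M).red (c ζ) = ζ_M` for all `M`), such that
for abc-iut-w4-d019's genuine record `thetaEnvRecordKummer … c (isOpen_stabilizer_units C) (finiteIndex_stabilizer_units C) O ι₀`
(`Ψ_cns := κ(O)`, `κ = h1LimKummerOn c … O` the Kummer map of the `Π^tp_X̲̲`-stable constant monoid `O` into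
`lim_J H¹(Π^tp_Ÿ̲̲ ∩ J, l·Δ_Θ)`): `Ψ_cns` is conjugation-stable; there is an isomorphism `O ⥲ Ψ_cns` which IS `κ` on elements,
INTERTWINES the Galois action through `ε` on `O` with the conjugation action `h1LimConjMulAut`, and is UNIQUE as such; and
`κ(x) ∈ M^×_TM ↔ IsUnit x` — abc-iut-w4-d019's `prop31ii_thetaEnvRecordKummer` with its input `hinj` supplied by
`h1LimKummer_injective_of_coeff` (this seat, p418848) at the `c` of `exists_cyclotomeCoefficients_of_cyclotomeTower`
(this seat, p422741) on the chain tower `cyclotomeTower mods hmods`. [claim: Mochizuki2012, status: disputed]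
(IUTchII §3 Prop 3.1 (ii), kurims p.88) -/
theorem prop31ii_thetaEnvRecordKummer_of_cyclotomeTower (hO' : D.IsEtThOrigin)
    (hΔ : IsCompact (D.DeltaTheta : Set D.GtpTheta)) :
    ∃ c : CyclotomeCoefficients (phi C) (D.lDeltaTheta l) (PadicAlgCl p)ˣ,
      Function.Bijective c.hom ∧
      (∀ (ζ : Literature.AnabelianGeometry.EtaleTheta.cyclotome (PadicAlgCl p)ˣ) (M : ℕ+),
        (((mods M).red (c.hom ζ) : MuN p M) : (PadicAlgCl p)ˣ) = (ζ : ℕ+ → (PadicAlgCl p)ˣ) M) ∧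
      ((thetaEnvRecordKummer C hC hS hl hp2 hpl hζ mods f hf hmods h15 L hZ hcharY hlim c (isOpen_stabilizer_units C)
            (finiteIndex_stabilizer_units C) O ι₀).IsConjStable
          (thetaEnvRecordKummer C hC hS hl hp2 hpl hζ mods f hf hmods h15 L hZ hcharY hlim c (isOpen_stabilizer_units C)
            (finiteIndex_stabilizer_units C) O ι₀).constantMonoid ∧
        (∃ e : O ≃*
            (thetaEnvRecordKummer C hC hS hl hp2 hpl hζ mods f hf hmods h15 L hZ hcharY hlim c (isOpen_stabilizer_units C)
              (finiteIndex_stabilizer_units C) O ι₀).constantMonoid,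
          (∀ x : O, ((e x : (thetaEnvRecordKummer C hC hS hl hp2 hpl hζ mods f hf hmods h15 L hZ hcharY hlim c
                (isOpen_stabilizer_units C) (finiteIndex_stabilizer_units C) O ι₀).constantMonoid) :
              (thetaEnvRecordKummer C hC hS hl hp2 hpl hζ mods f hf hmods h15 L hZ hcharY hlim c
                (isOpen_stabilizer_units C) (finiteIndex_stabilizer_units C) O ι₀).H) =
              h1LimKummerOn (phi C) (D.lDeltaTheta l) (PiYdd C) c (isOpen_stabilizer_units C)
                (finiteIndex_stabilizer_units C) O x) ∧
          (∀ (g : Pi C) (x : O),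
            ((e ⟨g • (x : (PadicAlgCl p)ˣ), hO g x x.2⟩ : (thetaEnvRecordKummer C hC hS hl hp2 hpl hζ mods f hf hmods h15 L
                hZ hcharY hlim c (isOpen_stabilizer_units C) (finiteIndex_stabilizer_units C) O ι₀).constantMonoid) :
                (thetaEnvRecordKummer C hC hS hl hp2 hpl hζ mods f hf hmods h15 L hZ hcharY hlim c
                  (isOpen_stabilizer_units C) (finiteIndex_stabilizer_units C) O ι₀).H) =
              h1LimConjMulAut (phi C) (D.lDeltaTheta l) (PiYdd C) g
                ((e x : (thetaEnvRecordKummer C hC hS hl hp2 hpl hζ mods f hf hmods h15 L hZ hcharY hlim c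
                  (isOpen_stabilizer_units C) (finiteIndex_stabilizer_units C) O ι₀).constantMonoid) :
                  (thetaEnvRecordKummer C hC hS hl hp2 hpl hζ mods f hf hmods h15 L hZ hcharY hlim c
                    (isOpen_stabilizer_units C) (finiteIndex_stabilizer_units C) O ι₀).H)) ∧
          (∀ e' : O ≃*
              (thetaEnvRecordKummer C hC hS hl hp2 hpl hζ mods f hf hmods h15 L hZ hcharY hlim c (isOpen_stabilizer_units C)
                (finiteIndex_stabilizer_units C) O ι₀).constantMonoid,
            (∀ x : O, ((e' x : (thetaEnvRecordKummer C hC hS hl hp2 hpl hζ mods f hf hmods h15 L hZ hcharY hlim c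
                  (isOpen_stabilizer_units C) (finiteIndex_stabilizer_units C) O ι₀).constantMonoid) :
                (thetaEnvRecordKummer C hC hS hl hp2 hpl hζ mods f hf hmods h15 L hZ hcharY hlim c
                  (isOpen_stabilizer_units C) (finiteIndex_stabilizer_units C) O ι₀).H) =
                h1LimKummerOn (phi C) (D.lDeltaTheta l) (PiYdd C) c (isOpen_stabilizer_units C)
                  (finiteIndex_stabilizer_units C) O x) → e' = e)) ∧
        (∀ x : O, h1LimKummerOn (phi C) (D.lDeltaTheta l) (PiYdd C) c (isOpen_stabilizer_units C)
              (finiteIndex_stabilizer_units C) O x ∈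
            (thetaEnvRecordKummer C hC hS hl hp2 hpl hζ mods f hf hmods h15 L hZ hcharY hlim c (isOpen_stabilizer_units C)
              (finiteIndex_stabilizer_units C) O ι₀).units ↔
          IsUnit x)) := by
  -- the coefficient iso from the chain tower of the model's identifications
  obtain ⟨c, hc, hlev⟩ := exists_cyclotomeCoefficients_of_cyclotomeTower C hO' hΔ
    (cyclotomeTower mods hmods (dvd_refl ((1 : ℕ+) : ℕ)))
  refine ⟨c, hc, fun ζ M => ?_, ?_⟩
  · -- the chain tower's all-level identification at `M` is `mods M` (compatibility `hmods`)
    have hmod : ((cyclotomeTower mods hmods (dvd_refl ((1 : ℕ+) : ℕ))).modAll M).red (c.hom ζ) =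
        (mods M).red (c.hom ζ) := by
      rw [ThetaSetting.CyclotomeTower.modAll_red, ThetaSetting.CyclotomeTower.redVia_apply]
      exact hmods M _ _ (c.hom ζ)
    rw [← hmod]
    exact hlev ζ M
  · -- `hinj` is a theorem at the model: `ε(Π^tp_Ÿ̲̲) = G_K` has finite index and `c` is bijective
    exact prop31ii_thetaEnvRecordKummer C hC hS hl hp2 hpl hζ mods f hf hmods h15 L hZ hcharY hlim c
      (isOpen_stabilizer_units C) (finiteIndex_stabilizer_units C) O hO ι₀
      (h1LimKummer_injective_of_coeff C (phi C) (D.lDeltaTheta l) c (PiYdd C) hc)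

end EtaleLevels

end Literature.IUT.HodgeArakelov

end
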